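import Literature.NumberTheory.Automorphic.CongruenceSubgroupPropertySL2Field
import Literature.NumberTheory.Automorphic.CongruenceSubgroupPropertySL2UnitsSpan
import Literature.NumberTheory.Automorphic.CongruenceSubgroupPropertySL2UnitOrders
import HarnessLib

/-!
# Serre's congruence subgroup property for `SL₂(𝓞_F)` — proofs, X: Vaserstein's Lemma 4, Case 2

Topic `Literature/NumberTheory/Automorphic`; namespace `Literature.NumberTheory.Automorphic.SL2Rel`.
Everything here is PROVED; no definitions, no named facts.

**Vaserstein 1972, Lemma 4**: for every non-zero ideal `I` of `A = 𝓞_K` and every `g ∈ GL₂(k)` the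
group `g E(I, I) g⁻¹` contains `E(I'', I'')` for some non-zero ideal `I''`.  This file proves the
heart of it, **Case 2: `g = (1 1; 0 1)`** (`SL2Rel.exists_relE_le_conj_e12_one`), following
Vaserstein's proof (p. 317–318) step by step, inside `SL₂(k)`:

1. `g E₁₂(I) g⁻¹ = E₁₂(I)`;
2. for a unit `u = 1 + xy`, `x, y ∈ I`, `U = diag(u, u⁻¹) = E₁₂(x)E₂₁(y)E₁₂(-xu⁻¹)E₂₁(-yu) ∈ E(I, I)`
   (the identity "из [6]"; every `N₀`-th power of a unit is such a `u`, `N₀ = #(A/z²A)ˣ`, `I ∋ z`);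
3. `g U g⁻¹ = U E₁₂(u⁻² - 1)`, so `U ∈ g E(I, I) g⁻¹`;
4. `X = {x : E₂₁(x) ∈ g E(I, I) g⁻¹}` is an additive group with `u^{±2} X = X`
   (`U⁻¹ E₂₁(x) U = E₂₁(u²x)`);
5. with `A = g E₂₁(y) g⁻¹ = (1+y, -y; y, 1-y)`, `c = (u² - 1)y/(1 + y) ∈ I` (for `u ≡ 1 (mod 1 + y)`),
   `U A U⁻¹ E₁₂(c) A⁻¹ = E₂₁((u⁻² - 1)y/(1 + y))`, a non-zero element of `X` when `u² ≠ 1` (here a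
   unit of infinite order is needed: the lemma is false for `A = ℤ`);
6. hence (`…UnitsSpan`: the powers of the units generate `k`, so `ℤ[u^{±2N₀} : u]` has finite index
   in `A`) `X` contains a non-zero ideal `(N x₀)`, and `I'' = (N x₀ z)` works.

## References

* [Vaserstein1972SL2] L. N. Vaserstein, Mat. Sb. 89 (131) (1972) 313–322, Lemma 4, Case 2
  (pp. 317–318).
* [Liehl1981SL2Orders] B. Liehl, J. reine angew. Math. 323 (1981) 153–171, end of §3.
-/

open Matrix MatrixGroups NumberField

namespace Literature.NumberTheory.Automorphic

namespace SL2Rel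

/-! ### Matrix identities over a commutative ring -/

section CommRing

variable {R : Type*} [CommRing R]

/-- **`diag(u, u⁻¹) = E₁₂(x) E₂₁(y) E₁₂(-xu⁻¹) E₂₁(-yu)`** for a unit `u = 1 + xy` (the identity by which
`diag(u, u⁻¹) ∈ E(I, I)` for `x, y ∈ I`; Vaserstein p. 317, Liehl p. 155): the entries of the
right hand side. [cite: Vaserstein1972SL2, Lemma 4 (proof)] -/
theorem diag_four_apply (x y : R) (u : Rˣ) (hu : (u : R) = 1 + x * y) :
    (e12 x * e21 y * e12 (-(x * ↑u⁻¹)) * e21 (-(y * u))) 0 0 = u ∧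
    (e12 x * e21 y * e12 (-(x * ↑u⁻¹)) * e21 (-(y * u))) 0 1 = 0 ∧
    (e12 x * e21 y * e12 (-(x * ↑u⁻¹)) * e21 (-(y * u))) 1 0 = 0 ∧
    (e12 x * e21 y * e12 (-(x * ↑u⁻¹)) * e21 (-(y * u))) 1 1 = ↑u⁻¹ := by
  have hinv : (u : R) * ↑u⁻¹ = 1 := u.mul_inv
  simp only [mul_apply_two, e12_apply_00, e12_apply_01, e12_apply_10, e12_apply_11, e21_apply_00,
    e21_apply_01, e21_apply_10, e21_apply_11]
  refine ⟨?_, ?_, ?_, ?_⟩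
  · linear_combination -(1 + x * y * u * ↑u⁻¹) * hu + (x * y * u) * hinv
  · linear_combination (x * ↑u⁻¹) * hu - x * hinv
  · linear_combination -y * hu + (x * y * y) * hinv
  · linear_combination (↑u⁻¹ : R) * hu - hinv

/-- For a diagonal `D = diag(p, q)` in `SL₂`: `E₁₂(1) D E₁₂(1)⁻¹ = D E₁₂(q² - 1)`. [folklore] -/
theorem e12_one_mul_diag_mul_inv (D : SL(2, R)) (h01 : D 0 1 = 0) (h10 : D 1 0 = 0) :
    e12 1 * D * (e12 1)⁻¹ = D * e12 (D 1 1 * D 1 1 - 1) := by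
  have hdet := det_two D
  rw [h01, h10] at hdet
  rw [← e12_neg]
  ext i j
  fin_cases i <;> fin_cases j <;>
    simp only [mul_apply_two, e12_apply_00, e12_apply_01, e12_apply_10, e12_apply_11, h01, h10,
      Fin.zero_eta, Fin.isValue, Fin.mk_one]
  · ring
  · linear_combination -(D 1 1) * hdet
  · ring
  · ring

/-- For a diagonal `D = diag(p, q)` in `SL₂`: `D⁻¹ E₂₁(x) D = E₂₁(p² x)`. [folklore] -/
theorem diag_inv_mul_e21_mul (D : SL(2, R)) (h01 : D 0 1 = 0) (h10 : D 1 0 = 0) (x : R) :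
    D⁻¹ * e21 x * D = e21 (D 0 0 * D 0 0 * x) := by
  have hdet := det_two D
  rw [h01, h10] at hdet
  obtain ⟨i00, i01, i10, i11⟩ := inv_apply_two D
  ext i j
  fin_cases i <;> fin_cases j <;>
    simp only [mul_apply_two, e21_apply_00, e21_apply_01, e21_apply_10, e21_apply_11, h01, h10,
      i00, i01, i10, i11, Fin.zero_eta, Fin.isValue, Fin.mk_one]
  · linear_combination hdet
  · ring
  · ring
  · linear_combination hdet

/-- **Vaserstein's commutator identity** (Lemma 4, Case 2, with `B = 1`): for `D = diag(p, q)` in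
`SL₂`, `A = E₁₂(1) E₂₁(y) E₁₂(1)⁻¹ = (1+y, -y; y, 1-y)` and `c = ty` with `t(1 + y) = p² - 1`,
`D A D⁻¹ E₁₂(c) A⁻¹ = E₂₁(-q²ty)`. [cite: Vaserstein1972SL2, Lemma 4 (proof of Case 2)] -/
theorem vaserstein_identity (D : SL(2, R)) (h01 : D 0 1 = 0) (h10 : D 1 0 = 0) (y t : R)
    (ht : t * (1 + y) = D 0 0 * D 0 0 - 1) :
    D * (e12 1 * e21 y * (e12 1)⁻¹) * D⁻¹ * e12 (t * y) * (e12 1 * e21 y * (e12 1)⁻¹)⁻¹ =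
      e21 (-(D 1 1 * D 1 1 * t) * y) := by
  have hdet := det_two D
  rw [h01, h10] at hdet
  obtain ⟨i00, i01, i10, i11⟩ := inv_apply_two D
  have hAinv : (e12 (1 : R) * e21 y * (e12 1)⁻¹)⁻¹ = e12 1 * e21 (-y) * (e12 1)⁻¹ := by
    rw [e21_neg, _root_.mul_inv_rev, _root_.mul_inv_rev, inv_inv, mul_assoc]
  rw [hAinv, ← e12_neg]
  ext i j
  fin_cases i <;> fin_cases j <;>
    simp only [mul_apply_two, e12_apply_00, e12_apply_01, e12_apply_10, e12_apply_11, e21_apply_00,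
      e21_apply_01, e21_apply_10, e21_apply_11, h01, h10, i00, i01, i10, i11, Fin.zero_eta,
      Fin.isValue, Fin.mk_one]
  · linear_combination (-y * y) * ht + (1 - y ^ 2 - y ^ 2 * t - y ^ 3 * t) * hdet
  · linear_combination ((1 + y) * y) * ht + (y + y * t + y ^ 2 + 2 * y ^ 2 * t + y ^ 3 * t) * hdet
  · linear_combination ((1 - y) * y * (D 1 1 * D 1 1)) * ht +
      ((1 - y) * y * (D 0 0 * D 1 1 + 1) + (y ^ 2 - y)) * hdet
  · linear_combination (D 1 1 * D 1 1 * y * y) * ht +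
      (y * y * (D 0 0 * D 1 1 + 1) + (1 - y ^ 2)) * hdet

end CommRing

/-! ### Case 2 of Lemma 4 over a ring of integers -/

section NumberField

variable {K : Type} [Field K] [NumberField K]

omit [NumberField K] in
/-- Every `N`-th power of a unit is `≡ 1 (mod J)`, `N = #(𝓞 K ⧸ J)ˣ` (Lagrange in the group
`(𝓞 K ⧸ J)ˣ`; `N = 0` if it is infinite). [folklore] -/
theorem units_pow_card_sub_one_mem (J : Ideal (𝓞 K)) (v : (𝓞 K)ˣ) :
    ((v ^ Nat.card ((𝓞 K ⧸ J)ˣ) : (𝓞 K)ˣ) : 𝓞 K) - 1 ∈ J := by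
  have h := pow_card_eq_one' (G := (𝓞 K ⧸ J)ˣ) (x := Units.map (Ideal.Quotient.mk J : 𝓞 K →* 𝓞 K ⧸ J) v)
  have h' : Ideal.Quotient.mk J (((v ^ Nat.card ((𝓞 K ⧸ J)ˣ) : (𝓞 K)ˣ) : 𝓞 K)) = 1 := by
    have := congrArg (fun w : (𝓞 K ⧸ J)ˣ ↦ (w : 𝓞 K ⧸ J)) h
    simp only [Units.val_pow_eq_pow_val, Units.coe_map, MonoidHom.coe_coe, Units.val_one] at this
    rw [Units.val_pow_eq_pow_val, map_pow]
    exact this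
  rw [← (Ideal.Quotient.mk J).map_one, Ideal.Quotient.eq] at h'
  exact h'

/-- **Vaserstein 1972, Lemma 4, Case 2** (`g = (1 1; 0 1)`), for the ring of integers of a number
field `K` with a real place and a unit of infinite order: for every ideal `I ≠ 0` of `𝓞 K` there is an
ideal `I'' ≠ 0` with `E(I'', I'') ⊆ g E(I, I) g⁻¹` in `SL₂(K)`.  See the module docstring for the six
steps of the proof. [cite: Vaserstein1972SL2, Lemma 4 (Case 2)] -/
theorem exists_relE_le_conj_e12_one (hreal : ∃ w : InfinitePlace K, w.IsReal)
    (hunit : ∃ v : (𝓞 K)ˣ, ∀ n : ℕ, n ≠ 0 → v ^ n ≠ 1) {I : Ideal (𝓞 K)} (hI : I ≠ ⊥) :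
    ∃ I'' : Ideal (𝓞 K), I'' ≠ ⊥ ∧
      (relE I'' I'').map (SpecialLinearGroup.map (algebraMap (𝓞 K) K)) ≤
        ((relE I I).map (SpecialLinearGroup.map (algebraMap (𝓞 K) K))).map
          (MulAut.conj (e12 (1 : K))).toMonoidHom := by
  classical
  set ι : SL(2, 𝓞 K) →* SL(2, K) := SpecialLinearGroup.map (algebraMap (𝓞 K) K) with hι
  set f := algebraMap (𝓞 K) K with hf
  set g : SL(2, K) := e12 1 with hg
  set H := ((relE I I).map ι).map (MulAut.conj g).toMonoidHom with hH
  have hHmem : ∀ M ∈ relE I I, g * ι M * g⁻¹ ∈ H := fun M hM ↦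
    Subgroup.mem_map.2 ⟨ι M, Subgroup.mem_map_of_mem _ hM, rfl⟩
  have hιe : ∀ M : SL(2, 𝓞 K), ∀ i j, (ι M) i j = f (M i j) := fun M i j ↦ rfl
  -- Step 0: `z = 2 z₁ ∈ I`, `z ≠ 0`, `1 + z ≠ 0`
  obtain ⟨z₁, hz₁I, hz₁0⟩ := Submodule.exists_mem_ne_zero_of_ne_bot hI
  set z : 𝓞 K := 2 * z₁ with hz
  have hzI : z ∈ I := I.mul_mem_left 2 hz₁I
  have hz0 : z ≠ 0 := mul_ne_zero two_ne_zero hz₁0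
  have h1z : 1 + z ≠ 0 := by
    intro h
    have h2u : ¬ IsUnit (2 : 𝓞 K) := by
      have := SerreSL2.not_isUnit_natCast_of_prime (K := K) Nat.prime_two
      norm_num at this
      exact this
    exact h2u (isUnit_iff_exists_inv.2 ⟨-z₁, by linear_combination -h⟩)
  -- Step 1: `E₁₂(x) ∈ H` for `x ∈ I`
  have h12 : ∀ x ∈ I, e12 (f x) ∈ H := by
    intro x hx
    have := hHmem (e12 x) (e12_mem_relE hx)
    rwa [hι, map_e12, hg, ← e12_neg, ← e12_add, ← e12_add,
      show (1 : K) + algebraMap (𝓞 K) K x + -1 = f x by rw [hf]; ring] at this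
  -- Step 2: the exponent `N₀`; for a unit `u ≡ 1 (mod z²)`, `U = diag(u, u⁻¹) ∈ E(I, I)`, `ι U ∈ H`
  set J : Ideal (𝓞 K) := Ideal.span {z * z} with hJ
  have hJ0 : J ≠ ⊥ := by rw [hJ, Ne, Ideal.span_singleton_eq_bot]; exact mul_ne_zero hz0 hz0
  have hJI : J ≤ I := by rw [hJ, Ideal.span_singleton_le_iff_mem]; exact I.mul_mem_left z hzI
  set N₀ : ℕ := Nat.card ((𝓞 K ⧸ J)ˣ) with hN₀
  have hN₀0 : N₀ ≠ 0 := by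
    haveI : Finite (𝓞 K ⧸ J) := Ideal.finiteQuotientOfFreeOfNeBot J hJ0
    exact Nat.card_pos.ne'
  have hdiag : ∀ u : (𝓞 K)ˣ, (u : 𝓞 K) - 1 ∈ J → ∃ U ∈ relE I I,
      U 0 0 = u ∧ U 0 1 = 0 ∧ U 1 0 = 0 ∧ U 1 1 = ↑u⁻¹ ∧ ι U ∈ H := by
    intro u hu
    obtain ⟨s, hs⟩ := Ideal.mem_span_singleton'.1 hu
    have hu' : (u : 𝓞 K) = 1 + z * (z * s) := by linear_combination -hs
    obtain ⟨h00, h01, h10, h11⟩ := diag_four_apply z (z * s) u hu'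
    have hUE : e12 z * e21 (z * s) * e12 (-(z * ↑u⁻¹)) * e21 (-(z * s * u)) ∈ relE I I :=
      mul_mem (mul_mem (mul_mem (e12_mem_relE hzI) (e21_mem_relE (I.mul_mem_right _ hzI)))
        (e12_mem_relE (I.neg_mem (I.mul_mem_right _ hzI))))
        (e21_mem_relE (I.neg_mem (I.mul_mem_right _ (I.mul_mem_right _ hzI))))
    refine ⟨e12 z * e21 (z * s) * e12 (-(z * ↑u⁻¹)) * e21 (-(z * s * u)), hUE, h00, h01, h10, h11, ?_⟩
    set U := e12 z * e21 (z * s) * e12 (-(z * ↑u⁻¹)) * e21 (-(z * s * u)) with hU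
    -- Step 3: `g ιU g⁻¹ = ιU E₁₂(u⁻² - 1)` and `u⁻² - 1 ∈ J ⊆ I`
    have hι01 : (ι U) 0 1 = 0 := by rw [hιe, h01, map_zero]
    have hι10 : (ι U) 1 0 = 0 := by rw [hιe, h10, map_zero]
    have hconj := e12_one_mul_diag_mul_inv (ι U) hι01 hι10
    have e2 : (ι U) 1 1 * (ι U) 1 1 - 1 = f (↑u⁻¹ * ↑u⁻¹ - 1) := by
      rw [hιe, h11, map_sub, map_mul, map_one]
    rw [e2] at hconj
    have hmem : (↑u⁻¹ * ↑u⁻¹ - 1 : 𝓞 K) ∈ I := by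
      apply hJI
      have e : (↑u⁻¹ * ↑u⁻¹ - 1 : 𝓞 K) = -(↑u⁻¹ * ↑u⁻¹ * (u + 1)) * (u - 1) := by
        linear_combination ((u⁻¹ : (𝓞 K)ˣ) * (u : 𝓞 K) + 1) * u.inv_mul
      rw [e]
      exact J.mul_mem_left _ hu
    have hgU : g * ι U * g⁻¹ ∈ H := hHmem U (by rw [hU]; exact hUE)
    have e : ι U = g * ι U * g⁻¹ * (e12 (f (↑u⁻¹ * ↑u⁻¹ - 1)))⁻¹ := by
      rw [hg, hconj, mul_inv_cancel_right]
    rw [e]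
    exact H.mul_mem hgU (H.inv_mem (h12 _ hmem))
  -- Step 4: the additive group `X = {x : E₂₁(x) ∈ H}` is stable under `u²`, `u = v^{N₀}`
  let X : AddSubgroup (𝓞 K) :=
    { carrier := {x | e21 (f x) ∈ H}
      zero_mem' := by
        simp only [Set.mem_setOf_eq, map_zero, e21_zero]
        exact H.one_mem
      add_mem' := fun {a b} ha hb ↦ by
        simp only [Set.mem_setOf_eq, map_add, e21_add]
        exact H.mul_mem ha hb
      neg_mem' := fun {a} ha ↦ by
        simp only [Set.mem_setOf_eq, map_neg, e21_neg]
        exact H.inv_mem ha }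
  have hXmem : ∀ x, x ∈ X ↔ e21 (f x) ∈ H := fun x ↦ Iff.rfl
  have hX : ∀ v : (𝓞 K)ˣ, ∀ x ∈ X, ((v ^ (2 * N₀) : (𝓞 K)ˣ) : 𝓞 K) * x ∈ X := by
    intro v x hx
    obtain ⟨U, -, h00, h01, h10, -, hUH⟩ := hdiag (v ^ N₀) (units_pow_card_sub_one_mem J v)
    have hι01 : (ι U) 0 1 = 0 := by rw [hιe, h01, map_zero]
    have hι10 : (ι U) 1 0 = 0 := by rw [hιe, h10, map_zero]
    have key := diag_inv_mul_e21_mul (ι U) hι01 hι10 (f x)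
    rw [hιe, h00, ← map_mul, ← map_mul] at key
    rw [hXmem, show ((v ^ (2 * N₀) : (𝓞 K)ˣ) : 𝓞 K) * x = ↑(v ^ N₀) * ↑(v ^ N₀) * x by
      rw [mul_comm 2, pow_mul, sq, Units.val_mul], ← key]
    exact H.mul_mem (H.mul_mem (H.inv_mem hUH) hx) hUH
  -- Step 5: a non-zero element of `X` from a unit of infinite order
  obtain ⟨v₀, hv₀⟩ := hunit
  set J₁ : Ideal (𝓞 K) := Ideal.span {1 + z} with hJ₁
  have hJ₁0 : J₁ ≠ ⊥ := by rw [hJ₁, Ne, Ideal.span_singleton_eq_bot]; exact h1z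
  set N₁ : ℕ := Nat.card ((𝓞 K ⧸ J₁)ˣ) with hN₁
  set u : (𝓞 K)ˣ := v₀ ^ (N₀ * N₁) with hu
  have huJ : (u : 𝓞 K) - 1 ∈ J := by
    rw [hu, mul_comm, pow_mul]; exact units_pow_card_sub_one_mem J (v₀ ^ N₁)
  have huJ₁ : (u : 𝓞 K) - 1 ∈ J₁ := by
    rw [hu, pow_mul]; exact units_pow_card_sub_one_mem J₁ (v₀ ^ N₀)
  obtain ⟨U, -, h00, h01, h10, h11, hUH⟩ := hdiag u huJ
  have hdvd : (u : 𝓞 K) * u - 1 ∈ J₁ := by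
    rw [show (u : 𝓞 K) * u - 1 = (u + 1) * (u - 1) by ring]
    exact J₁.mul_mem_left _ huJ₁
  obtain ⟨t, ht⟩ := Ideal.mem_span_singleton'.1 hdvd
  -- `ht : t * (1 + z) = u * u - 1`
  set x₀ : 𝓞 K := -(↑u⁻¹ * ↑u⁻¹ * t) * z with hx₀
  have hx₀X : x₀ ∈ X := by
    rw [hXmem]
    have hι01 : (ι U) 0 1 = 0 := by rw [hιe, h01, map_zero]
    have hι10 : (ι U) 1 0 = 0 := by rw [hιe, h10, map_zero]
    have key := vaserstein_identity (ι U) hι01 hι10 (f z) (f t)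
      (by rw [hιe, h00, ← map_mul, ← f.map_one, ← map_add, ← map_mul, ← map_sub, ht])
    have hgz : e12 1 * e21 (f z) * (e12 1)⁻¹ = g * ι (e21 z) * g⁻¹ := by rw [hg, hι, map_e21]
    have hA : e12 1 * e21 (f z) * (e12 1)⁻¹ ∈ H := by rw [hgz]; exact hHmem _ (e21_mem_relE hzI)
    have hC : e12 (f t * f z) ∈ H := by rw [← map_mul]; exact h12 _ (I.mul_mem_left _ hzI)
    have lhs_mem : ι U * (e12 1 * e21 (f z) * (e12 1)⁻¹) * (ι U)⁻¹ * e12 (f t * f z) *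
        (e12 1 * e21 (f z) * (e12 1)⁻¹)⁻¹ ∈ H :=
      H.mul_mem (H.mul_mem (H.mul_mem (H.mul_mem hUH hA) (H.inv_mem hUH)) hC) (H.inv_mem hA)
    rw [key, hιe, h11] at lhs_mem
    rw [hx₀]
    simpa only [map_mul, map_neg] using lhs_mem
  have hx₀0 : x₀ ≠ 0 := by
    rw [hx₀]
    refine mul_ne_zero (neg_ne_zero.2 (mul_ne_zero (mul_ne_zero (Units.ne_zero _) (Units.ne_zero _))
      fun ht0 ↦ ?_)) hz0
    rw [ht0, zero_mul, eq_comm, sub_eq_zero] at ht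
    apply hv₀ (N₀ * N₁ * 2) (mul_ne_zero (mul_ne_zero hN₀0 ?_) two_ne_zero)
    · ext
      rw [pow_mul, ← hu, Units.val_pow_eq_pow_val, sq, ht, Units.val_one]
    · haveI : Finite (𝓞 K ⧸ J₁) := Ideal.finiteQuotientOfFreeOfNeBot J₁ hJ₁0
      exact Nat.card_pos.ne'
  -- Step 6: `X ⊇ (N x₀)`, and `I'' = (N x₀ z)`
  obtain ⟨N, hN, hNX⟩ := SerreSL2.exists_span_singleton_le_of_units_pow_mul_mem hreal
    (mul_ne_zero two_ne_zero hN₀0) X hX hx₀X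
  refine ⟨Ideal.span {(N : 𝓞 K) * x₀ * z}, ?_, ?_⟩
  · rw [Ne, Ideal.span_singleton_eq_bot]
    exact mul_ne_zero (mul_ne_zero (Nat.cast_ne_zero.2 hN) hx₀0) hz0
  · rw [map_relE, Subgroup.closure_le]
    rintro _ (⟨x, hx, rfl⟩ | ⟨x, hx, rfl⟩)
    · rw [SetLike.mem_coe] at hx
      obtain ⟨r, rfl⟩ := Ideal.mem_span_singleton'.1 hx
      exact h12 _ (I.mul_mem_left _ (I.mul_mem_left _ hzI))
    · rw [SetLike.mem_coe] at hx
      obtain ⟨r, rfl⟩ := Ideal.mem_span_singleton'.1 hx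
      have := hNX (r * z)
      rw [hXmem] at this
      rw [SetLike.mem_coe, show r * ((N : 𝓞 K) * x₀ * z) = (N : 𝓞 K) * x₀ * (r * z) by ring]
      exact this

end NumberField


end SL2Rel

end Literature.NumberTheory.Automorphic
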